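import Summits.BirchSwinnertonDyer.BirchSwinnertonDyer.Theorems.PrintCf2RamifiedOffTYZPartnerShaDiagonalQuartics
import HarnessLib

/-!
# Crux `PrintCf2.RamifiedOffTYZOfFacts` (stmt-BirchSwinnertonDyer-20509), line `offtyz-v7`, LEAD cycle 21 (cruxlead-20509 g20), part 5/6:
# THE `φ̂`-SELMER GROUP ON R2 — `dim S(0, −l²q²) = 3` — and the local solubility of the classes `l`, `2` of `Sel^{(φ)}`

THEOREMS ONLY (no `def`, no named fact, no `sorry`), `--supports stmt-BirchSwinnertonDyer-20509`.  Setting (the block-free two-prime sector R2 of the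
lineage's census): primes `l ≡ 1 (mod 8)`, `q ≡ 7 (mod 8)` with `(l/q) = (q/l) = 1` (hypotheses `IsSquare (l : ZMod q)`, `IsSquare (q : ZMod l)`;
either implies the other by reciprocity, both are taken), `n = lq`, `E_n = E_{0,−n²}`, `A_n = E_n' : Y² = X³ + 4n²X`.

* §8 `natCast_mem_twoIsogenySelmerGroup_R2` (`l, q ∈ S(0,−n²)`), `torsion_mem_twoIsogenySelmerGroup_R2` (`−1, ±lq ∈ S`), `card_primeFactors_R2`,
  and **`twoIsogenySelmerRank_R2` : `dim S(0, −l²q²) = 3`** (`Sel^{(φ̂)}(A_{lq} → E_{lq}) = {±1, ±l, ±q, ±lq}`: six explicit classes, `#S` a power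
  of `2`, `#S ≤ 2^{ω+1} = 8`).
* §9 (first half) `isLocallySoluble_l_class_R2` (`w² = l u⁴ + 4lq² z⁴`: exact zero `u = (1+i)√q ∈ ℤ_l`, `u⁴ = −4q²`) and
  `isLocallySoluble_two_class_R2` (`w² = 2u⁴ + 2n² z⁴`: `2 + 2n² = 4m`, `m ≡ 1 (mod 8)` at `2`; `√2 ∈ ℤ_l, ℤ_q`).
Beyond-print theorem: NO (a routine `2`-isogeny descent, as in the lineage's instrument `descent_A.py`/`dclass_search.py`).  BSD is not proved by
any of this; C⁺ (23431) and the crux stay OPEN.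

References: [cite: SilvermanAEC2009, Prop. X.4.9, Example X.4.10, Prop. X.6.2(b)]; [cite: SilvermanTate2015, §3.6]; [cite: TianYuanZhang2017, §1 (A_n, φ_n)].
-/

noncomputable section

open scoped Classical

open WeierstrassCurve Literature.NumberTheory Literature.NumberTheory.EllipticCurves Literature.NumberTheory.DiophantineGeometry
  Literature.NumberTheory.DiophantineGeometry.LindMordellQuartics Literature.NumberTheory.EllipticCurves.TianYuanZhang2017

namespace Summit.BirchSwinnertonDyer.PrintCf2.PartnerSha

/-- Squarefreeness is invariant under sign. [folklore] -/
private theorem squarefree_neg_int {d : ℤ} (h : Squarefree d) : Squarefree (-d) :=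
  Int.squarefree_natAbs.mp (by rw [Int.natAbs_neg]; exact Int.squarefree_natAbs.mpr h)

/-- `b / d = d'` from `d · d' = b`. [folklore] -/
private theorem ediv_eq_of_mul_eq_left {b d d' : ℤ} (hd : d ≠ 0) (h : d * d' = b) : b / d = d' := by
  rw [← h, Int.mul_ediv_cancel_left _ hd]

/-- A prime `≥ 5` is what remains after excluding `2` and `3`. [folklore] -/
private theorem five_le_of_prime_ne {p : ℕ} (hp : p.Prime) (h2 : p ≠ 2) (h3 : p ≠ 3) : 5 ≤ p := by
  by_contra h
  interval_cases p <;> first | exact absurd hp (by decide) | omega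

/-- Residues mod `3` of a prime `≠ 3`. [folklore] -/
private theorem mod_three_of_prime_ne_three {p : ℕ} (hp : p.Prime) (h3 : p ≠ 3) : p % 3 = 1 ∨ p % 3 = 2 := by
  have : p % 3 ≠ 0 := fun h0 => by
    have h := (Nat.dvd_prime hp).mp (Nat.dvd_of_mod_eq_zero h0)
    omega
  omega

/-! ## §8 `Sel^{(φ̂)}(A_{lq} → E_{lq})` on R2: `dim S(0, −l²q²) = 3` -/

section R2

variable {l q : ℕ} [hlp : Fact l.Prime] [hqp : Fact q.Prime]

/-- The parameters of the sector: `b = −(lq)²` is nonzero and `b(a² − 4b) ≠ 0` for `a = 0`. [folklore] -/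
theorem hb_R2 : (-(((l * q : ℕ) : ℤ)) ^ 2) ≠ 0 := by
  have : ((l * q : ℕ) : ℤ) ≠ 0 := by exact_mod_cast (Nat.mul_ne_zero hlp.out.ne_zero hqp.out.ne_zero)
  exact neg_ne_zero.mpr (pow_ne_zero 2 this)

/-- **`l, q ∈ Sel^{(φ̂)}` on R2.** For primes `l ≡ 1 (mod 8)`, `q ≡ 7 (mod 8)` with `(l/q) = (q/l) = 1`, the classes `q` and `l` lie in
`S(0, −l²q²)` (the descent on the divisors of `−n²` for `E_n = E_{0,−n²}`, `n = lq`). [cite: SilvermanAEC2009, Prop. X.4.9] -/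
theorem natCast_mem_twoIsogenySelmerGroup_R2 (hl8 : l % 8 = 1) (hq8 : q % 8 = 7)
    (hlq : IsSquare ((l : ℤ) : ZMod q)) (hql : IsSquare ((q : ℤ) : ZMod l)) :
    (q : ℤ) ∈ twoIsogenySelmerGroup 0 (-(((l * q : ℕ) : ℤ)) ^ 2) ∧
      (l : ℤ) ∈ twoIsogenySelmerGroup 0 (-(((l * q : ℕ) : ℤ)) ^ 2) := by
  have hl := hlp.out
  have hq := hqp.out
  have hlq_ne : l ≠ q := by rintro rfl; omega
  have hl2 : l ≠ 2 := by rintro rfl; omega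
  have hl3 : l ≠ 3 := by rintro rfl; omega
  have hq2 : q ≠ 2 := by rintro rfl; omega
  have hq3 : q ≠ 3 := by rintro rfl; omega
  have hb := hb_R2 (l := l) (q := q)
  constructor
  · rw [mem_twoIsogenySelmerGroup_iff hb]
    refine ⟨Int.squarefree_natCast.mpr hq.prime.squarefree, ⟨-((l : ℤ) ^ 2 * q), by push_cast; ring⟩, ?_⟩
    rw [ediv_eq_of_mul_eq_left (by exact_mod_cast hq.ne_zero) (d' := -((l : ℤ) ^ 2 * q)) (by push_cast; ring),
      twoIsogenyQuartic_zero]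
    exact isLocallySoluble_diag_prime_negSq (Ne.symm hlq_ne) (Or.inr hq8) hl2 hl3 hlq hql
  · rw [mem_twoIsogenySelmerGroup_iff hb]
    refine ⟨Int.squarefree_natCast.mpr hl.prime.squarefree, ⟨-((q : ℤ) ^ 2 * l), by push_cast; ring⟩, ?_⟩
    rw [ediv_eq_of_mul_eq_left (by exact_mod_cast hl.ne_zero) (d' := -((q : ℤ) ^ 2 * l)) (by push_cast; ring),
      twoIsogenyQuartic_zero]
    exact isLocallySoluble_diag_prime_negSq hlq_ne (Or.inl hl8) hq2 hq3 hql hlq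

/-- The global classes `±lq` (`w² = ±(lq u⁴ − lq z⁴)` has the rational point `(1, 1, 0)`) and `−1` (`−n²/(−1) = n²` is a square)
lie in `S(0, −l²q²)`. [cite: SilvermanAEC2009, Prop. X.4.9] -/
theorem torsion_mem_twoIsogenySelmerGroup_R2 (hlq_ne : l ≠ q) :
    (-1 : ℤ) ∈ twoIsogenySelmerGroup 0 (-(((l * q : ℕ) : ℤ)) ^ 2) ∧
      ((l * q : ℕ) : ℤ) ∈ twoIsogenySelmerGroup 0 (-(((l * q : ℕ) : ℤ)) ^ 2) ∧
      (-((l * q : ℕ) : ℤ)) ∈ twoIsogenySelmerGroup 0 (-(((l * q : ℕ) : ℤ)) ^ 2) := by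
  have hl := hlp.out
  have hq := hqp.out
  have hb := hb_R2 (l := l) (q := q)
  have hn0 : ((l * q : ℕ) : ℤ) ≠ 0 := by exact_mod_cast (Nat.mul_ne_zero hl.ne_zero hq.ne_zero)
  have hsqn : Squarefree ((l * q : ℕ) : ℤ) :=
    Int.squarefree_natCast.mpr (Nat.squarefree_mul_iff.mpr
      ⟨(Nat.coprime_primes hl hq).mpr hlq_ne, hl.prime.squarefree, hq.prime.squarefree⟩)
  -- the diagonal form `⟨d, 0, 0, 0, −d⟩` has the point `(1, 1, 0)` everywhere
  have hself : ∀ d : ℤ, (twoIsogenyQuartic 0 d (-d)).IsLocallySoluble := fun d =>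
    ⟨⟨1, 1, 0, Or.inl one_ne_zero, by rw [eval_map_twoIsogenyQuartic]; simp⟩,
      fun p _ => ⟨1, 1, 0, Or.inl one_ne_zero, by rw [eval_map_twoIsogenyQuartic]; simp⟩⟩
  refine ⟨?_, ?_, ?_⟩
  · refine mem_twoIsogenySelmerGroup_of_isSquare hb (squarefree_neg_int squarefree_one) ⟨((l * q : ℕ) : ℤ) ^ 2, by ring⟩ ?_
    exact ⟨((l * q : ℕ) : ℤ), by rw [Int.ediv_neg, Int.ediv_one]; ring⟩
  · rw [mem_twoIsogenySelmerGroup_iff hb]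
    refine ⟨hsqn, ⟨-((l * q : ℕ) : ℤ), by ring⟩, ?_⟩
    rw [ediv_eq_of_mul_eq_left hn0 (d' := -((l * q : ℕ) : ℤ)) (by ring)]
    exact hself _
  · rw [mem_twoIsogenySelmerGroup_iff hb]
    refine ⟨squarefree_neg_int hsqn, ⟨((l * q : ℕ) : ℤ), by ring⟩, ?_⟩
    rw [ediv_eq_of_mul_eq_left (neg_ne_zero.mpr hn0) (d' := ((l * q : ℕ) : ℤ)) (by ring)]
    have := hself (-((l * q : ℕ) : ℤ))
    rwa [neg_neg] at this

/-- `ω(l²q²) = 2`. [folklore] -/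
theorem card_primeFactors_R2 (hlq_ne : l ≠ q) :
    ((-(((l * q : ℕ) : ℤ)) ^ 2).natAbs).primeFactors.card = 2 := by
  have hl := hlp.out
  have hq := hqp.out
  rw [Int.natAbs_neg, Int.natAbs_pow, Int.natAbs_natCast, Nat.primeFactors_pow _ two_ne_zero,
    Nat.primeFactors_mul hl.ne_zero hq.ne_zero, hl.primeFactors, hq.primeFactors,
    Finset.card_union_of_disjoint (by simpa using hlq_ne)]
  simp

/-- **`dim S(0, −l²q²) = 3` on R2**: `Sel^{(φ̂)}(A_{lq} → E_{lq}) = {±1, ±l, ±q, ±lq}` has order `8` — six explicit classes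
(`1, −1, l, q, lq, −lq`), `#S` a power of `2` and `≤ 2^{ω+1} = 8`. [cite: SilvermanAEC2009, Prop. X.4.9] [cite: SilvermanTate2015, §3.6] -/
theorem twoIsogenySelmerRank_R2 (hl8 : l % 8 = 1) (hq8 : q % 8 = 7)
    (hlq : IsSquare ((l : ℤ) : ZMod q)) (hql : IsSquare ((q : ℤ) : ZMod l)) :
    twoIsogenySelmerRank 0 (-(((l * q : ℕ) : ℤ)) ^ 2) = 3 := by
  have hl := hlp.out
  have hq := hqp.out
  have hlq_ne : l ≠ q := by rintro rfl; omega
  have hb := hb_R2 (l := l) (q := q)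
  have hab : (-(((l * q : ℕ) : ℤ)) ^ 2) * ((0 : ℤ) ^ 2 - 4 * (-(((l * q : ℕ) : ℤ)) ^ 2)) ≠ 0 := by
    have : ((l * q : ℕ) : ℤ) ≠ 0 := by exact_mod_cast (Nat.mul_ne_zero hl.ne_zero hq.ne_zero)
    have h4 : (0 : ℤ) ^ 2 - 4 * (-(((l * q : ℕ) : ℤ)) ^ 2) = 4 * (((l * q : ℕ) : ℤ)) ^ 2 := by ring
    rw [h4]; positivity
  obtain ⟨hqS, hlS⟩ := natCast_mem_twoIsogenySelmerGroup_R2 hl8 hq8 hlq hql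
  obtain ⟨hm1, hn, hmn⟩ := torsion_mem_twoIsogenySelmerGroup_R2 (l := l) (q := q) hlq_ne
  have h1 := one_mem_twoIsogenySelmerGroup (0 : ℤ) hb
  -- six distinct members
  set T : Finset ℤ := {1, -1, (l : ℤ), (q : ℤ), ((l * q : ℕ) : ℤ), -((l * q : ℕ) : ℤ)} with hT
  have hl1 : 1 < l := hl.one_lt
  have hq1 : 1 < q := hq.one_lt
  have hTcard : T.card = 6 := by
    have hlqZ : ((l * q : ℕ) : ℤ) = (l : ℤ) * q := by push_cast; ring
    have h1 : (1 : ℤ) < l := by exact_mod_cast hl1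
    have h2 : (1 : ℤ) < q := by exact_mod_cast hq1
    have h3 : (l : ℤ) ≠ q := by exact_mod_cast hlq_ne
    have h4 : (l : ℤ) < (l : ℤ) * q := by nlinarith
    have h5 : (q : ℤ) < (l : ℤ) * q := by nlinarith
    have key : ∀ N : ℤ, (l : ℤ) < N → (q : ℤ) < N →
        ({1, -1, (l : ℤ), (q : ℤ), N, -N} : Finset ℤ).card = 6 := by
      intro N hN1 hN2
      rw [Finset.card_insert_of_notMem (by simp only [Finset.mem_insert, Finset.mem_singleton]; omega),
        Finset.card_insert_of_notMem (by simp only [Finset.mem_insert, Finset.mem_singleton]; omega),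
        Finset.card_insert_of_notMem (by simp only [Finset.mem_insert, Finset.mem_singleton]; omega),
        Finset.card_insert_of_notMem (by simp only [Finset.mem_insert, Finset.mem_singleton]; omega),
        Finset.card_insert_of_notMem (by simp only [Finset.mem_singleton]; omega),
        Finset.card_singleton]
    rw [hT, hlqZ]
    exact key _ h4 h5
  have hsub : T ⊆ twoIsogenySelmerGroup 0 (-(((l * q : ℕ) : ℤ)) ^ 2) := by
    intro d hd
    simp only [hT, Finset.mem_insert, Finset.mem_singleton] at hd
    rcases hd with rfl | rfl | rfl | rfl | rfl | rfl
    · exact h1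
    · exact hm1
    · exact hlS
    · exact hqS
    · exact hn
    · exact hmn
  have h6 : 6 ≤ (twoIsogenySelmerGroup 0 (-(((l * q : ℕ) : ℤ)) ^ 2)).card := hTcard ▸ Finset.card_le_card hsub
  have h8 : (twoIsogenySelmerGroup 0 (-(((l * q : ℕ) : ℤ)) ^ 2)).card ≤ 8 := by
    have := card_twoIsogenySelmerGroup_le (0 : ℤ) hb
    rwa [card_primeFactors_R2 hlq_ne] at this
  obtain ⟨k, hk⟩ := exists_card_twoIsogenySelmerGroup_eq_two_pow hab
  have hk3 : k = 3 := by
    rw [hk] at h6 h8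
    rcases Nat.lt_or_ge k 3 with hlt | hge
    · interval_cases k <;> simp_all
    · rcases Nat.lt_or_ge k 4 with hlt4 | hge4
      · omega
      · have : 2 ^ 4 ≤ 2 ^ k := Nat.pow_le_pow_right two_pos hge4
        omega
  have h2 := two_pow_twoIsogenySelmerRank_eq_card hab
  rw [hk, hk3] at h2
  exact Nat.pow_right_injective le_rfl h2

end R2

/-! ## §9 `Sel^{(φ)}(E_{lq} → A_{lq})` on R2: `S(0, 4l²q²) = {1, 2, l, 2l}`, `dim S'(0, −l²q²) = 2` -/

section R2'

variable {l q : ℕ} [hlp : Fact l.Prime] [hqp : Fact q.Prime]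

/-- In `ZMod 3`, the square of a non-multiple of `3` is `1`. [folklore] -/
theorem sq_eq_one_zmod_three {R : ℕ} (hR : R % 3 = 1 ∨ R % 3 = 2) : (R : ZMod 3) ^ 2 = 1 := by
  rcases hR with h | h <;> rw [← ZMod.natCast_mod R 3, h] <;> decide

/-- **The class `l` of `Sel^{(φ)}` on R2**: `w² = l u⁴ + 4lq² z⁴` is everywhere locally soluble — at `l` the exact zero
`u = (1 + i)√q ∈ ℤ_l` (`u⁴ = −4q²`; `i = √−1`, `√q ∈ ℤ_l` since `l ≡ 1 (mod 8)`, `(q/l) = 1`), at `q` and `2` the point `(1, 0, √l)`,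
at `3` a unit square value, elsewhere good reduction. [cite: SilvermanAEC2009, Prop. X.4.9, Example X.4.10 (method)] -/
theorem isLocallySoluble_l_class_R2 (hl8 : l % 8 = 1) (hq8 : q % 8 = 7)
    (hlq : IsSquare ((l : ℤ) : ZMod q)) (hql : IsSquare ((q : ℤ) : ZMod l)) :
    (⟨l, 0, 0, 0, 4 * l * (q : ℤ) ^ 2⟩ : BinaryQuartic ℤ).IsLocallySoluble := by
  have hl := hlp.out
  have hq := hqp.out
  have hlq_ne : l ≠ q := by rintro rfl; omega
  have hl2 : l ≠ 2 := by rintro rfl; omega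
  have hl3 : l ≠ 3 := by rintro rfl; omega
  have hq2 : q ≠ 2 := by rintro rfl; omega
  have hq3 : q ≠ 3 := by rintro rfl; omega
  have hlnq : ¬ (l : ℤ) ∣ q := fun h =>
    hlq_ne ((Nat.prime_dvd_prime_iff_eq hl hq).mp (by exact_mod_cast h))
  have hqnl : ¬ (q : ℤ) ∣ l := fun h =>
    hlq_ne ((Nat.prime_dvd_prime_iff_eq hq hl).mp (by exact_mod_cast h)).symm
  refine ⟨?_, fun p hp => ?_⟩
  · have := isSoluble_real_twoIsogenyQuartic_of_pos (d := l) (by exact_mod_cast hl.pos) 0 (4 * l * (q : ℤ) ^ 2)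
    rwa [twoIsogenyQuartic_zero] at this
  · have hpP := hp.out
    by_cases hpl : p = l
    · -- the exact zero `((1 + ι)s, 1, 0)`
      subst hpl
      obtain ⟨ι, hι⟩ := LocalFields.padicInt_exists_sq_eq_neg_one (p := p) (by omega)
      obtain ⟨s, hs⟩ := exists_sq_eq_intCast_of_isSquare hl2 hlnq hql
      refine isSoluble_padic_diag_of_point (x := (1 + ι) * s) (y := 1) (z := 0) (Or.inr one_ne_zero) ?_
      have h4 : ((1 + ι) * s) ^ 4 = -4 * ((q : ℤ) : ℤ_[p]) ^ 2 := by
        have : ((1 + ι) * s) ^ 4 = ((1 + ι) ^ 2) ^ 2 * (s ^ 2) ^ 2 := by ring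
        rw [this, hs, show (1 + ι) ^ 2 = 1 + 2 * ι + ι ^ 2 by ring, hι]
        ring_nf
        rw [hι]; ring
      rw [h4]; push_cast; ring
    by_cases hpq : p = q
    · subst hpq
      obtain ⟨r, hr⟩ := exists_sq_eq_intCast_of_isSquare hq2 hqnl hlq
      exact isSoluble_padic_diag_of_point (x := 1) (y := 0) (z := r) (Or.inl one_ne_zero)
        (by rw [hr]; push_cast; ring)
    by_cases hp2 : p = 2
    · subst hp2
      obtain ⟨r, hr⟩ := exists_sq_eq_two_of_emod_eight (c := l) (by exact_mod_cast (show (l : ℤ) % 8 = 1 by omega))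
      exact isSoluble_padic_diag_of_point (x := 1) (y := 0) (z := r) (Or.inl one_ne_zero)
        (by rw [hr]; push_cast; ring)
    by_cases hp3 : p = 3
    · subst hp3
      have hq3' := sq_eq_one_zmod_three (mod_three_of_prime_ne_three hq hq3)
      rcases mod_three_of_prime_ne_three hl hl3 with h1 | h2
      · -- `(0, 1, √(4lq²))`, `4lq² ≡ l ≡ 1 (mod 3)`
        obtain ⟨r, hr⟩ := exists_sq_eq_intCast (q := 3) (by norm_num) (c := 4 * l * (q : ℤ) ^ 2) (w := 1)
          (by norm_num) (by
            refine (ZMod.intCast_zmod_eq_zero_iff_dvd _ 3).mp ?_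
            have hl' : (l : ZMod 3) = 1 := by rw [← ZMod.natCast_mod l 3, h1]; rfl
            push_cast; rw [hq3', hl']; reduce_mod_char)
        exact isSoluble_padic_diag_of_point (x := 0) (y := 1) (z := r) (Or.inr one_ne_zero)
          (by rw [hr]; push_cast; ring)
      · -- `(1, 1, √(l + 4lq²))`, `≡ 2 + 2 ≡ 1 (mod 3)`
        obtain ⟨r, hr⟩ := exists_sq_eq_intCast (q := 3) (by norm_num) (c := l + 4 * l * (q : ℤ) ^ 2) (w := 1)
          (by norm_num) (by
            refine (ZMod.intCast_zmod_eq_zero_iff_dvd _ 3).mp ?_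
            have hl' : (l : ZMod 3) = 2 := by rw [← ZMod.natCast_mod l 3, h2]; rfl
            push_cast; rw [hq3', hl']; reduce_mod_char)
        exact isSoluble_padic_diag_of_point (x := 1) (y := 1) (z := r) (Or.inl one_ne_zero)
          (by rw [hr]; push_cast; ring)
    · have hp5 := five_le_of_prime_ne hpP hp2 hp3
      have hpi : Prime (p : ℤ) := Nat.prime_iff_prime_int.mp hpP
      have hpnl : ¬ (p : ℤ) ∣ l := fun h => hpl ((Nat.prime_dvd_prime_iff_eq hpP hl).mp (by exact_mod_cast h))
      have hpnq : ¬ (p : ℤ) ∣ q := fun h => hpq ((Nat.prime_dvd_prime_iff_eq hpP hq).mp (by exact_mod_cast h))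
      have hpn2 : ¬ (p : ℤ) ∣ 4 := fun h => by
        have : (p : ℤ) ∣ 2 ^ 2 := by norm_num; exact h
        have h2 := Int.le_of_dvd (by norm_num) (hpi.dvd_of_dvd_pow this)
        omega
      refine isSoluble_padic_diag_of_five_le hp5 hpnl ?_
      intro h
      rcases hpi.dvd_or_dvd h with h1 | h1
      · rcases hpi.dvd_or_dvd h1 with h3 | h3
        · exact hpn2 h3
        · exact hpnl h3
      · exact hpnq (hpi.dvd_of_dvd_pow h1)

/-- **The class `2` of `Sel^{(φ)}` on R2**: `w² = 2u⁴ + 2l²q² z⁴` is everywhere locally soluble — at `2` the point `(1, 1, 2√m)` with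
`2 + 2(lq)² = 4m`, `m ≡ 1 (mod 8)` (`lq ≡ 7 (mod 8)`), at `l` and `q` the point `(1, 0, √2)` (`l ≡ 1`, `q ≡ 7 (mod 8)`), at `3` the
point `(1, 1, ·)`, elsewhere good reduction. [cite: SilvermanAEC2009, Prop. X.4.9, proof of Prop. X.6.2(b) (2 ∈ S^{(φ)} for p ≡ ±1 (8))] -/
theorem isLocallySoluble_two_class_R2 (hl8 : l % 8 = 1) (hq8 : q % 8 = 7) :
    (⟨2, 0, 0, 0, 2 * (l : ℤ) ^ 2 * (q : ℤ) ^ 2⟩ : BinaryQuartic ℤ).IsLocallySoluble := by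
  have hl := hlp.out
  have hq := hqp.out
  have hl2 : l ≠ 2 := by rintro rfl; omega
  have hl3 : l ≠ 3 := by rintro rfl; omega
  have hq2 : q ≠ 2 := by rintro rfl; omega
  have hq3 : q ≠ 3 := by rintro rfl; omega
  refine ⟨?_, fun p hp => ?_⟩
  · have := isSoluble_real_twoIsogenyQuartic_of_pos (d := 2) (by norm_num) 0 (2 * (l : ℤ) ^ 2 * (q : ℤ) ^ 2)
    rwa [twoIsogenyQuartic_zero] at this
  · have hpP := hp.out
    by_cases hp2 : p = 2
    · subst hp2
      -- `lq = 8k + 7`, `2 + 2(lq)² = 4m`, `m = 32k² + 56k + 25 ≡ 1 (mod 8)`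
      have hn7 : (l * q) % 8 = 7 := by rw [Nat.mul_mod, hl8, hq8]
      obtain ⟨k, hk⟩ : ∃ k, l * q = 8 * k + 7 := by
        refine ⟨l * q / 8, ?_⟩
        generalize hN : l * q = N at hn7 ⊢
        omega
      set m : ℤ := 32 * k ^ 2 + 56 * k + 25 with hm
      have hm8 : m % 8 = 1 := by
        rw [hm, show (32 * (k : ℤ) ^ 2 + 56 * k + 25 : ℤ) = 1 + 8 * (4 * (k : ℤ) ^ 2 + 7 * k + 3) by ring,
          Int.add_mul_emod_self_left]
        norm_num
      obtain ⟨r, hr⟩ := exists_sq_eq_two_of_emod_eight hm8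
      refine isSoluble_padic_diag_of_point (x := 1) (y := 1) (z := 2 * r) (Or.inl one_ne_zero) ?_
      have hlq : ((l : ℤ)) * q = 8 * k + 7 := by exact_mod_cast hk
      have key : (2 : ℤ) + 2 * (l : ℤ) ^ 2 * (q : ℤ) ^ 2 = 4 * m := by
        rw [hm]
        linear_combination (2 * ((l : ℤ) * q) + 2 * (8 * (k : ℤ) + 7)) * hlq
      have key' : ((2 : ℤ) : ℤ_[2]) * 1 ^ 4 + ((2 * (l : ℤ) ^ 2 * (q : ℤ) ^ 2 : ℤ) : ℤ_[2]) * 1 ^ 4 = 4 * (m : ℤ_[2]) := by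
        have := congrArg (fun x : ℤ => (x : ℤ_[2])) key
        push_cast at this ⊢
        linear_combination this
      rw [key', mul_pow, hr]; ring
    by_cases hpl : p = l
    · subst hpl
      have hl2' := hl.two_le
      obtain ⟨r, hr⟩ := exists_sq_eq_intCast_of_isSquare (q := p) hl2 (c := 2)
        (by intro h; have := Int.le_of_dvd (by norm_num) h; omega)
        (by have := (ZMod.exists_sq_eq_two_iff hl2).mpr (Or.inl hl8); exact_mod_cast this)
      exact isSoluble_padic_diag_of_point (x := 1) (y := 0) (z := r) (Or.inl one_ne_zero)
        (by rw [hr]; push_cast; ring)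
    by_cases hpq : p = q
    · subst hpq
      obtain ⟨r, hr⟩ := exists_sq_eq_intCast_of_isSquare (q := p) hq2 (c := 2)
        (by intro h; have := Int.le_of_dvd (by norm_num) h; omega)
        (by have := (ZMod.exists_sq_eq_two_iff hq2).mpr (Or.inr hq8); exact_mod_cast this)
      exact isSoluble_padic_diag_of_point (x := 1) (y := 0) (z := r) (Or.inl one_ne_zero)
        (by rw [hr]; push_cast; ring)
    by_cases hp3 : p = 3
    · subst hp3
      have hl3' := sq_eq_one_zmod_three (mod_three_of_prime_ne_three hl hl3)
      have hq3' := sq_eq_one_zmod_three (mod_three_of_prime_ne_three hq hq3)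
      obtain ⟨r, hr⟩ := exists_sq_eq_intCast (q := 3) (by norm_num) (c := 2 + 2 * (l : ℤ) ^ 2 * (q : ℤ) ^ 2) (w := 1)
        (by norm_num) (by
          refine (ZMod.intCast_zmod_eq_zero_iff_dvd _ 3).mp ?_
          push_cast; rw [hq3', hl3']; reduce_mod_char)
      exact isSoluble_padic_diag_of_point (x := 1) (y := 1) (z := r) (Or.inl one_ne_zero)
        (by rw [hr]; push_cast; ring)
    · have hp5 := five_le_of_prime_ne hpP hp2 hp3
      have hpi : Prime (p : ℤ) := Nat.prime_iff_prime_int.mp hpP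
      have hpnl : ¬ (p : ℤ) ∣ l := fun h => hpl ((Nat.prime_dvd_prime_iff_eq hpP hl).mp (by exact_mod_cast h))
      have hpnq : ¬ (p : ℤ) ∣ q := fun h => hpq ((Nat.prime_dvd_prime_iff_eq hpP hq).mp (by exact_mod_cast h))
      have hpn2 : ¬ (p : ℤ) ∣ 2 := fun h => by
        have h2 := Int.le_of_dvd (by norm_num) h
        omega
      refine isSoluble_padic_diag_of_five_le hp5 hpn2 ?_
      intro h
      rcases hpi.dvd_or_dvd h with h1 | h1
      · rcases hpi.dvd_or_dvd h1 with h3 | h3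
        · exact hpn2 h3
        · exact hpnl (hpi.dvd_of_dvd_pow h3)
      · exact hpnq (hpi.dvd_of_dvd_pow h1)

end R2'

end Summit.BirchSwinnertonDyer.PrintCf2.PartnerSha

end
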